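import Literature.Geometry.Lorentzian.InverseSmoothAmplitudes
import Literature.Geometry.Lorentzian.TeukolskyRealAxisModeStabilityProofs
import Mathlib.Analysis.SpecialFunctions.ImproperIntegrals
import HarnessLib

/-!
# Regularised oscillatory integrals of symbols on a half-line

Generic analytic input of the proof programme for the named fact
`Literature.Geometry.Lorentzian.Kerr.Costa2019_realAxisModeStability` (R. Teixeira da Costa,
Commun. Math. Phys. 378 (2020) 705–781 = arXiv:1910.02854 [Costa2019], Thm. 4.1): the passage
`y → 0` in Whiting's transform (TdC Lemma 3.10, Lemma 3.12: "by an easy adaptation of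
Lemma 3.10, `g̃` … can be differentiated under the integral sign at `y = 0`") rests on the fact
that, for a symbol `g(r) = r^d G(1/r)` (`Costa2019.IsInvSmooth`), the Laplace-type integral
`I_g(λ) = ∫_{r₁}^∞ g(r) e^{λ(r−r₁)} dr`, absolutely convergent for `Re λ < 0`, extends — after
`d + 4` integrations by parts (`Costa2019.integral_Ioi_mul_exp_eq_ibp`) — to a function on the
closed half-plane `Re λ ≤ 0`, `λ ≠ 0`, which is continuous there together with a derivative
*within* the half-plane, and bounded for `|λ| ≥ 1`
(`Costa2019.IsInvSmooth.exists_regularisedIntegral`). The base case is the absolutely convergent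
one (`d ≤ −4`), where differentiability within the closed half-plane is proved directly from the
elementary kernel estimate `|e^{bt} − e^{at} − (b−a)t e^{at}| ≤ |b−a|² t²` (`Re a, Re b ≤ 0`,
`t ≥ 0`). Everything is proved.

## References
* R. Teixeira da Costa, CMP 378 (2020) 705–781, arXiv:1910.02854, Lemma 3.10, Lemma 3.12.
  [Costa2019]
-/

noncomputable section

open Complex Set MeasureTheory Filter Topology Asymptotics

namespace Literature.Geometry.Lorentzian.Kerr

namespace Costa2019

/-! ### Kernel estimates in the closed left half-plane -/

/-- `|e^{λt}| ≤ 1` for `Re λ ≤ 0`, `t ≥ 0`. [folklore] -/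
theorem norm_cexp_mul_real_le_one {lam : ℂ} (hlam : lam.re ≤ 0) {t : ℝ} (ht : 0 ≤ t) :
    ‖Complex.exp (lam * t)‖ ≤ 1 := by
  rw [Complex.norm_exp, Complex.mul_re, Complex.ofReal_re, Complex.ofReal_im, mul_zero, sub_zero]
  exact Real.exp_le_one_iff.2 (mul_nonpos_of_nonpos_of_nonneg hlam ht)

/-- `|e^{bt} − e^{at}| ≤ |b − a| t` for `Re a, Re b ≤ 0`, `t ≥ 0`. [folklore] -/
theorem norm_cexp_sub_cexp_le {a b : ℂ} (ha : a.re ≤ 0) (hb : b.re ≤ 0) {t : ℝ} (ht : 0 ≤ t) :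
    ‖Complex.exp (b * t) - Complex.exp (a * t)‖ ≤ ‖b - a‖ * t := by
  -- `φ(θ) = e^{t(a + θ(b−a))}`, `φ' = t(b−a)φ`, `|φ| ≤ 1` on `[0,1]`
  set φ : ℝ → ℂ := fun θ => Complex.exp ((a + θ * (b - a)) * t) with hφ
  have hφd : ∀ θ, HasDerivAt φ (φ θ * ((b - a) * t)) θ := by
    intro θ
    have h1 : HasDerivAt (fun θ : ℝ => (a + θ * (b - a)) * t) ((b - a) * t) θ := by
      have h0 : HasDerivAt (fun θ : ℝ => (θ : ℂ)) 1 θ := by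
        simpa using (hasDerivAt_id θ).ofReal_comp
      have := ((h0.mul_const (b - a)).const_add a).mul_const (t : ℂ)
      simpa using this
    simpa [hφ] using h1.cexp
  have hφn : ∀ θ ∈ Icc (0 : ℝ) 1, ‖φ θ‖ ≤ 1 := by
    intro θ hθ
    have hre : ((a + θ * (b - a)) : ℂ).re ≤ 0 := by
      simp only [Complex.add_re, Complex.mul_re, Complex.ofReal_re, Complex.ofReal_im, zero_mul,
        sub_zero, Complex.sub_re]
      nlinarith [hθ.1, hθ.2]
    exact norm_cexp_mul_real_le_one hre ht
  have hmvt := norm_image_sub_le_of_norm_deriv_le_segment' (f := φ) (a := 0) (b := 1)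
    (C := ‖b - a‖ * t) (fun θ _ => (hφd θ).hasDerivWithinAt) (fun θ hθ => by
      rw [norm_mul, norm_mul, Complex.norm_real, Real.norm_eq_abs, abs_of_nonneg ht]
      calc ‖φ θ‖ * (‖b - a‖ * t) ≤ 1 * (‖b - a‖ * t) :=
          mul_le_mul_of_nonneg_right (hφn θ (Ico_subset_Icc_self hθ)) (by positivity)
        _ = ‖b - a‖ * t := one_mul _) 1 (right_mem_Icc.2 zero_le_one)
  have e1 : φ 1 = Complex.exp (b * t) := by simp [hφ]
  have e0 : φ 0 = Complex.exp (a * t) := by simp [hφ]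
  simpa [e1, e0] using hmvt

/-- **Second-order kernel estimate in the closed left half-plane**:
`|e^{bt} − e^{at} − (b − a) t e^{at}| ≤ |b − a|² t²` for `Re a, Re b ≤ 0`, `t ≥ 0`. [folklore] -/
theorem norm_cexp_sub_cexp_sub_le {a b : ℂ} (ha : a.re ≤ 0) (hb : b.re ≤ 0) {t : ℝ} (ht : 0 ≤ t) :
    ‖Complex.exp (b * t) - Complex.exp (a * t) - (b - a) * t * Complex.exp (a * t)‖ ≤
      ‖b - a‖ ^ 2 * t ^ 2 := by
  -- `ψ(θ) = e^{t(a+θ(b−a))} − θ t(b−a) e^{at}`, `ψ' = t(b−a)(e^{t(a+θ(b−a))} − e^{at})`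
  set c : ℝ → ℂ := fun θ => a + θ * (b - a) with hc
  have hcre : ∀ θ ∈ Icc (0 : ℝ) 1, (c θ).re ≤ 0 := by
    intro θ hθ
    simp only [hc, Complex.add_re, Complex.mul_re, Complex.ofReal_re, Complex.ofReal_im, zero_mul,
      sub_zero, Complex.sub_re]
    nlinarith [hθ.1, hθ.2]
  set ψ : ℝ → ℂ := fun θ => Complex.exp (c θ * t) - θ * ((b - a) * t * Complex.exp (a * t))
    with hψ
  have hψd : ∀ θ, HasDerivAt ψ ((b - a) * t * (Complex.exp (c θ * t) - Complex.exp (a * t))) θ := by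
    intro θ
    have h0 : HasDerivAt (fun θ : ℝ => (θ : ℂ)) 1 θ := by
      simpa using (hasDerivAt_id θ).ofReal_comp
    have h1 : HasDerivAt (fun θ : ℝ => c θ * t) ((b - a) * t) θ := by
      have := ((h0.mul_const (b - a)).const_add a).mul_const (t : ℂ)
      simpa [hc] using this
    have h2 := h1.cexp
    have h3 := h0.mul_const ((b - a) * t * Complex.exp (a * t))
    refine (h2.sub h3).congr_deriv ?_
    ring
  have hbound : ∀ θ ∈ Ico (0 : ℝ) 1,
      ‖(b - a) * t * (Complex.exp (c θ * t) - Complex.exp (a * t))‖ ≤ ‖b - a‖ ^ 2 * t ^ 2 := by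
    intro θ hθ
    have h := norm_cexp_sub_cexp_le ha (hcre θ (Ico_subset_Icc_self hθ)) ht
    have hca : c θ - a = θ * (b - a) := by simp [hc]
    rw [hca, norm_mul, Complex.norm_real, Real.norm_eq_abs, abs_of_nonneg hθ.1] at h
    rw [norm_mul, norm_mul, Complex.norm_real, Real.norm_eq_abs, abs_of_nonneg ht]
    have hθ1 : θ * ‖b - a‖ * t ≤ ‖b - a‖ * t := by
      have : 0 ≤ ‖b - a‖ * t := by positivity
      nlinarith [hθ.1, hθ.2]
    calc ‖b - a‖ * t * ‖Complex.exp (c θ * ↑t) - Complex.exp (a * ↑t)‖ ≤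
        ‖b - a‖ * t * (‖b - a‖ * t) :=
          mul_le_mul_of_nonneg_left (h.trans hθ1) (by positivity)
      _ = ‖b - a‖ ^ 2 * t ^ 2 := by ring
  have hmvt := norm_image_sub_le_of_norm_deriv_le_segment' (f := ψ) (a := 0) (b := 1)
    (fun θ _ => (hψd θ).hasDerivWithinAt) hbound 1 (right_mem_Icc.2 zero_le_one)
  have e1 : ψ 1 = Complex.exp (b * t) - (b - a) * t * Complex.exp (a * t) := by
    simp [hψ, hc]
  have e0 : ψ 0 = Complex.exp (a * t) := by simp [hψ, hc]
  rw [e1, e0] at hmvt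
  have : Complex.exp (b * t) - Complex.exp (a * t) - (b - a) * t * Complex.exp (a * t) =
      Complex.exp (b * t) - (b - a) * t * Complex.exp (a * t) - Complex.exp (a * t) := by ring
  rw [this]
  simpa using hmvt

/-! ### Regularisations: the predicate -/

/-- The closed left half-plane minus the origin. [folklore] -/
def leftHalfPlane₀ : Set ℂ := {lam : ℂ | lam.re ≤ 0 ∧ lam ≠ 0}

/-- **Regularised Laplace-type integral on a half-line.** `IsHalfLineRegularisation r₁ g F F'`
means: `F, F' : ℂ → ℂ` satisfy (a) `F(λ) = ∫_{r₁}^∞ g(r) e^{λ(r−r₁)} dr` and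
(a') `F'(λ) = ∫_{r₁}^∞ (r − r₁) g(r) e^{λ(r−r₁)} dr` for `Re λ < 0` (absolutely convergent there
for polynomially bounded `g`); (b) `F`, `F'` are continuous on `{Re λ ≤ 0, λ ≠ 0}`; (c) `F'` is
the derivative of `F` *within* that set; (d) `F`, `F'` are bounded on `{Re λ ≤ 0, |λ| ≥ 1}`.
This is the regularity in `λ = A(z − r₋)` of the far-field pieces of Whiting's transform down
to the real axis `y = 0` (TdC Lemma 3.10 / 3.12). [cite: Costa2019, Lemma 3.10, Lemma 3.12] -/
def IsHalfLineRegularisation (r₁ : ℝ) (g : ℝ → ℂ) (F F' : ℂ → ℂ) : Prop :=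
  (∀ lam : ℂ, lam.re < 0 →
      F lam = ∫ r in Ioi r₁, g r * Complex.exp (lam * ((r - r₁ : ℝ) : ℂ))) ∧
    (∀ lam : ℂ, lam.re < 0 →
      F' lam = ∫ r in Ioi r₁, g r * ((r - r₁ : ℝ) : ℂ) * Complex.exp (lam * ((r - r₁ : ℝ) : ℂ))) ∧
    ContinuousOn F leftHalfPlane₀ ∧ ContinuousOn F' leftHalfPlane₀ ∧
    (∀ lam ∈ leftHalfPlane₀, HasDerivWithinAt F (F' lam) leftHalfPlane₀ lam) ∧
    ∃ C : ℝ, ∀ lam ∈ leftHalfPlane₀, 1 ≤ ‖lam‖ → ‖F lam‖ ≤ C ∧ ‖F' lam‖ ≤ C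

/-! ### The absolutely convergent case -/

/-- Polynomial decay `|ψ| ≤ C r^a`, `a < −1`, gives integrability on `(r₁, ∞)`, `r₁ > 0`.
[folklore] -/
theorem integrableOn_Ioi_of_norm_le_rpow {E : Type*} [NormedAddCommGroup E] {ψ : ℝ → E}
    {r₁ C a : ℝ} (hr₁ : 0 < r₁) (ha : a < -1) (hψc : ContinuousOn ψ (Ioi r₁))
    (hψb : ∀ r, r₁ < r → ‖ψ r‖ ≤ C * r ^ a) : IntegrableOn ψ (Ioi r₁) := by
  have hg : IntegrableOn (fun r : ℝ => C * r ^ a) (Ioi r₁) :=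
    (integrableOn_Ioi_rpow_of_lt ha hr₁).const_mul C
  refine hg.mono' (hψc.aestronglyMeasurable measurableSet_Ioi) ?_
  exact ae_restrict_of_forall_mem measurableSet_Ioi fun r hr => hψb r hr

/-- **The absolutely convergent case.** If `φ` is continuous on `(r₀, ∞)` (`r₀ > 0`) with
`|φ(r)| ≤ C r^d` there, `d ≤ −4`, and `r₁ > r₀`, then `F(λ) = ∫_{r₁}^∞ φ e^{λ(r−r₁)}` and
`F'(λ) = ∫_{r₁}^∞ (r−r₁) φ e^{λ(r−r₁)}` form a half-line regularisation of `φ`: continuity by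
dominated convergence (`|e^{λt}| ≤ 1`), differentiability within the closed half-plane from
`|e^{bt} − e^{at} − (b−a)te^{at}| ≤ |b−a|²t²`. [cite: Costa2019, Lemma 3.10 (case of an
absolutely convergent integral)] -/
theorem isHalfLineRegularisation_of_norm_le {φ : ℝ → ℂ} {r₀ r₁ C : ℝ} {d : ℤ} (hr₀ : 0 < r₀)
    (hr₁ : r₀ < r₁) (hd : d ≤ -4) (hφc : ContinuousOn φ (Ioi r₀))
    (hφb : ∀ r, r₀ < r → ‖φ r‖ ≤ C * r ^ d) :
    IsHalfLineRegularisation r₁ φ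
      (fun lam => ∫ r in Ioi r₁, φ r * Complex.exp (lam * ((r - r₁ : ℝ) : ℂ)))
      (fun lam => ∫ r in Ioi r₁, φ r * ((r - r₁ : ℝ) : ℂ) * Complex.exp (lam * ((r - r₁ : ℝ) : ℂ))) := by
  have hr₁0 : 0 < r₁ := hr₀.trans hr₁
  have hIoi : ∀ r ∈ Ioi r₁, r₀ < r := fun r hr => hr₁.trans hr
  have hφc₁ : ContinuousOn φ (Ioi r₁) := hφc.mono fun r hr => hIoi r hr
  have hC : 0 ≤ C := by
    have h := (norm_nonneg _).trans (hφb r₁ hr₁)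
    exact le_of_mul_le_mul_right (by simpa using h) (zpow_pos hr₁0 d)
  -- the weights `w_j(r) = (r − r₁)^j |φ(r)|`, `j ≤ 2`, are integrable on `(r₁, ∞)`
  have hw : ∀ j : ℕ, j ≤ 2 → IntegrableOn (fun r => (r - r₁) ^ j * ‖φ r‖) (Ioi r₁) := by
    intro j hj
    have hd' : (d : ℝ) ≤ -4 := by exact_mod_cast hd
    refine integrableOn_Ioi_of_norm_le_rpow (C := C) (a := (j : ℝ) + d) hr₁0 (by
      have : (j : ℝ) ≤ 2 := by exact_mod_cast hj
      linarith) ?_ fun r hr => ?_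
    · exact ((continuous_id.sub continuous_const).pow j).continuousOn.mul hφc₁.norm
    · have hr0 : 0 < r := hr₁0.trans hr
      rw [Real.norm_eq_abs, abs_of_nonneg (mul_nonneg (pow_nonneg (sub_pos.2 hr).le _)
        (norm_nonneg _))]
      have h1 : (r - r₁) ^ j ≤ r ^ j := pow_le_pow_left₀ (sub_pos.2 hr).le (by linarith) j
      have h2 : ‖φ r‖ ≤ C * r ^ d := hφb r (hIoi r hr)
      calc (r - r₁) ^ j * ‖φ r‖ ≤ r ^ j * (C * r ^ d) :=
            mul_le_mul h1 h2 (norm_nonneg _) (pow_nonneg hr0.le _)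
        _ = C * r ^ ((j : ℝ) + d) := by
            rw [Real.rpow_add hr0, Real.rpow_natCast, Real.rpow_intCast]
            ring
  -- the integrands `φ t^j e^{λt}` and their domination by `w_j`
  have hker_c : ∀ (lam : ℂ) (j : ℕ), ContinuousOn
      (fun r : ℝ => φ r * ((r - r₁ : ℝ) : ℂ) ^ j * Complex.exp (lam * ((r - r₁ : ℝ) : ℂ))) (Ioi r₁) :=
    fun lam j => (hφc₁.mul (((Complex.continuous_ofReal.comp (continuous_id.sub
      continuous_const)).pow j).continuousOn)).mul ((Complex.continuous_exp.comp
        (continuous_const.mul (Complex.continuous_ofReal.comp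
          (continuous_id.sub continuous_const)))).continuousOn)
  have hker_b : ∀ (lam : ℂ), lam.re ≤ 0 → ∀ (j : ℕ), ∀ r ∈ Ioi r₁,
      ‖φ r * ((r - r₁ : ℝ) : ℂ) ^ j * Complex.exp (lam * ((r - r₁ : ℝ) : ℂ))‖ ≤
        (r - r₁) ^ j * ‖φ r‖ := by
    intro lam hlam j r hr
    rw [norm_mul, norm_mul, norm_pow, Complex.norm_real, Real.norm_eq_abs,
      abs_of_nonneg (sub_pos.2 hr).le]
    have h1 := norm_cexp_mul_real_le_one hlam (sub_pos.2 (mem_Ioi.1 hr)).le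
    calc ‖φ r‖ * (r - r₁) ^ j * ‖Complex.exp (lam * ((r - r₁ : ℝ) : ℂ))‖ ≤
        ‖φ r‖ * (r - r₁) ^ j * 1 :=
          mul_le_mul_of_nonneg_left h1 (mul_nonneg (norm_nonneg _)
            (pow_nonneg (sub_pos.2 (mem_Ioi.1 hr)).le _))
      _ = (r - r₁) ^ j * ‖φ r‖ := by ring
  have hker_i : ∀ (lam : ℂ), lam.re ≤ 0 → ∀ (j : ℕ), j ≤ 2 → IntegrableOn
      (fun r : ℝ => φ r * ((r - r₁ : ℝ) : ℂ) ^ j * Complex.exp (lam * ((r - r₁ : ℝ) : ℂ)))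
        (Ioi r₁) := by
    intro lam hlam j hj
    refine (hw j hj).mono' ((hker_c lam j).aestronglyMeasurable measurableSet_Ioi) ?_
    exact ae_restrict_of_forall_mem measurableSet_Ioi (hker_b lam hlam j)
  -- continuity on the closed half-plane by dominated convergence
  have hcont : ∀ (j : ℕ), j ≤ 2 → ContinuousOn (fun lam : ℂ => ∫ r in Ioi r₁,
      φ r * ((r - r₁ : ℝ) : ℂ) ^ j * Complex.exp (lam * ((r - r₁ : ℝ) : ℂ))) {lam | lam.re ≤ 0} := by
    intro j hj
    refine continuousOn_of_dominated (bound := fun r => (r - r₁) ^ j * ‖φ r‖) ?_ ?_ ?_ ?_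
    · exact fun lam _ => (hker_c lam j).aestronglyMeasurable measurableSet_Ioi
    · exact fun lam hlam => ae_restrict_of_forall_mem measurableSet_Ioi (hker_b lam hlam j)
    · exact hw j hj
    · refine ae_restrict_of_forall_mem measurableSet_Ioi fun r _ => ?_
      exact (continuous_const.mul (Complex.continuous_exp.comp
        (continuous_id.mul continuous_const))).continuousOn
  -- simplify the `j = 0, 1` integrands
  have hF0 : (fun lam : ℂ => ∫ r in Ioi r₁, φ r * Complex.exp (lam * ((r - r₁ : ℝ) : ℂ))) =
      fun lam => ∫ r in Ioi r₁, φ r * ((r - r₁ : ℝ) : ℂ) ^ 0 * Complex.exp (lam * ((r - r₁ : ℝ) : ℂ)) := by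
    funext lam; simp
  have hF1 : (fun lam : ℂ => ∫ r in Ioi r₁, φ r * ((r - r₁ : ℝ) : ℂ) *
      Complex.exp (lam * ((r - r₁ : ℝ) : ℂ))) =
      fun lam => ∫ r in Ioi r₁, φ r * ((r - r₁ : ℝ) : ℂ) ^ 1 * Complex.exp (lam * ((r - r₁ : ℝ) : ℂ)) := by
    funext lam; simp
  refine ⟨fun lam _ => rfl, fun lam _ => rfl, ?_, ?_, ?_, ?_⟩
  · rw [hF0]; exact (hcont 0 (by norm_num)).mono fun lam hlam => hlam.1
  · rw [hF1]; exact (hcont 1 (by norm_num)).mono fun lam hlam => hlam.1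
  · -- differentiability within the closed half-plane
    intro lam hlam
    refine HasDerivWithinAt.mono (t := {mu : ℂ | mu.re ≤ 0}) ?_ fun mu hmu => hmu.1
    rw [hasDerivWithinAt_iff_isLittleO]
    set C₂ : ℝ := (∫ r in Ioi r₁, (r - r₁) ^ 2 * ‖φ r‖) + 1 with hC₂
    have hC₂0 : 0 < C₂ := by
      have : 0 ≤ ∫ r in Ioi r₁, (r - r₁) ^ 2 * ‖φ r‖ :=
        setIntegral_nonneg measurableSet_Ioi fun r hr =>
          mul_nonneg (pow_nonneg (sub_pos.2 hr).le _) (norm_nonneg _)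
      linarith
    -- the quadratic bound on the Taylor remainder
    have hquad : ∀ mu : ℂ, mu.re ≤ 0 →
        ‖(∫ r in Ioi r₁, φ r * Complex.exp (mu * ((r - r₁ : ℝ) : ℂ))) -
            (∫ r in Ioi r₁, φ r * Complex.exp (lam * ((r - r₁ : ℝ) : ℂ))) -
            (mu - lam) • ∫ r in Ioi r₁, φ r * ((r - r₁ : ℝ) : ℂ) *
              Complex.exp (lam * ((r - r₁ : ℝ) : ℂ))‖ ≤ C₂ * ‖mu - lam‖ ^ 2 := by
      intro mu hmu
      have hi_mu := hker_i mu hmu 0 (by norm_num)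
      have hi_lam := hker_i lam hlam.1 0 (by norm_num)
      have hi_lam1 := hker_i lam hlam.1 1 (by norm_num)
      simp only [pow_zero, mul_one, pow_one] at hi_mu hi_lam hi_lam1
      have e1 : ∫ r in Ioi r₁, (φ r * Complex.exp (mu * ((r - r₁ : ℝ) : ℂ)) -
          φ r * Complex.exp (lam * ((r - r₁ : ℝ) : ℂ))) =
          (∫ r in Ioi r₁, φ r * Complex.exp (mu * ((r - r₁ : ℝ) : ℂ))) -
            ∫ r in Ioi r₁, φ r * Complex.exp (lam * ((r - r₁ : ℝ) : ℂ)) := integral_sub hi_mu hi_lam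
      have e2 : ∫ r in Ioi r₁, (φ r * Complex.exp (mu * ((r - r₁ : ℝ) : ℂ)) -
          φ r * Complex.exp (lam * ((r - r₁ : ℝ) : ℂ)) -
          (mu - lam) * (φ r * ((r - r₁ : ℝ) : ℂ) * Complex.exp (lam * ((r - r₁ : ℝ) : ℂ)))) =
          (∫ r in Ioi r₁, (φ r * Complex.exp (mu * ((r - r₁ : ℝ) : ℂ)) -
            φ r * Complex.exp (lam * ((r - r₁ : ℝ) : ℂ)))) -
            ∫ r in Ioi r₁, (mu - lam) * (φ r * ((r - r₁ : ℝ) : ℂ) *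
              Complex.exp (lam * ((r - r₁ : ℝ) : ℂ))) :=
        integral_sub (show Integrable (fun r => φ r * Complex.exp (mu * ((r - r₁ : ℝ) : ℂ)) -
          φ r * Complex.exp (lam * ((r - r₁ : ℝ) : ℂ))) (volume.restrict (Ioi r₁)) from
            hi_mu.sub hi_lam) (hi_lam1.const_mul _)
      have e3 : ∫ r in Ioi r₁, (mu - lam) * (φ r * ((r - r₁ : ℝ) : ℂ) *
          Complex.exp (lam * ((r - r₁ : ℝ) : ℂ))) =
          (mu - lam) * ∫ r in Ioi r₁, φ r * ((r - r₁ : ℝ) : ℂ) *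
            Complex.exp (lam * ((r - r₁ : ℝ) : ℂ)) := integral_const_mul _ _
      rw [smul_eq_mul, ← e3, ← e1, ← e2]
      have hpt : ∀ r ∈ Ioi r₁, ‖φ r * Complex.exp (mu * ((r - r₁ : ℝ) : ℂ)) -
          φ r * Complex.exp (lam * ((r - r₁ : ℝ) : ℂ)) -
          (mu - lam) * (φ r * ((r - r₁ : ℝ) : ℂ) * Complex.exp (lam * ((r - r₁ : ℝ) : ℂ)))‖ ≤
          ‖mu - lam‖ ^ 2 * ((r - r₁) ^ 2 * ‖φ r‖) := by
        intro r hr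
        have ht : 0 ≤ r - r₁ := (sub_pos.2 (mem_Ioi.1 hr)).le
        have hk := norm_cexp_sub_cexp_sub_le hlam.1 hmu ht
        have : φ r * Complex.exp (mu * ((r - r₁ : ℝ) : ℂ)) -
            φ r * Complex.exp (lam * ((r - r₁ : ℝ) : ℂ)) -
            (mu - lam) * (φ r * ((r - r₁ : ℝ) : ℂ) * Complex.exp (lam * ((r - r₁ : ℝ) : ℂ))) =
            φ r * (Complex.exp (mu * ((r - r₁ : ℝ) : ℂ)) - Complex.exp (lam * ((r - r₁ : ℝ) : ℂ)) -
              (mu - lam) * ((r - r₁ : ℝ) : ℂ) * Complex.exp (lam * ((r - r₁ : ℝ) : ℂ))) := by ring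
        rw [this, norm_mul]
        calc ‖φ r‖ * _ ≤ ‖φ r‖ * (‖mu - lam‖ ^ 2 * (r - r₁) ^ 2) :=
              mul_le_mul_of_nonneg_left hk (norm_nonneg _)
          _ = ‖mu - lam‖ ^ 2 * ((r - r₁) ^ 2 * ‖φ r‖) := by ring
      calc _ ≤ ∫ r in Ioi r₁, ‖mu - lam‖ ^ 2 * ((r - r₁) ^ 2 * ‖φ r‖) := by
            refine norm_integral_le_of_norm_le (((hw 2 le_rfl).const_mul _)) ?_
            exact ae_restrict_of_forall_mem measurableSet_Ioi hpt
        _ = ‖mu - lam‖ ^ 2 * ∫ r in Ioi r₁, (r - r₁) ^ 2 * ‖φ r‖ := integral_const_mul _ _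
        _ ≤ C₂ * ‖mu - lam‖ ^ 2 := by
            rw [mul_comm]
            exact mul_le_mul_of_nonneg_right (by linarith) (sq_nonneg _)
    refine isLittleO_iff.2 fun ε hε => ?_
    have hball : {mu : ℂ | ‖mu - lam‖ < ε / C₂} ∈ 𝓝[{mu : ℂ | mu.re ≤ 0}] lam := by
      refine mem_nhdsWithin_of_mem_nhds ?_
      have : {mu : ℂ | ‖mu - lam‖ < ε / C₂} = Metric.ball lam (ε / C₂) := by
        ext mu; simp [dist_eq_norm]
      rw [this]
      exact Metric.ball_mem_nhds _ (div_pos hε hC₂0)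
    filter_upwards [hball, self_mem_nhdsWithin] with mu hmu hmu0
    have h1 := hquad mu hmu0
    have h2 : C₂ * ‖mu - lam‖ ^ 2 ≤ ε * ‖mu - lam‖ := by
      have h3 : C₂ * ‖mu - lam‖ ≤ ε := by
        have := (lt_div_iff₀ hC₂0).1 (hmu : ‖mu - lam‖ < ε / C₂)
        linarith
      calc C₂ * ‖mu - lam‖ ^ 2 = (C₂ * ‖mu - lam‖) * ‖mu - lam‖ := by ring
        _ ≤ ε * ‖mu - lam‖ := mul_le_mul_of_nonneg_right h3 (norm_nonneg _)
    exact h1.trans h2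
  · -- bounds for `|λ| ≥ 1` (in fact on the whole closed half-plane)
    refine ⟨max (∫ r in Ioi r₁, (r - r₁) ^ 0 * ‖φ r‖) (∫ r in Ioi r₁, (r - r₁) ^ 1 * ‖φ r‖),
      fun lam hlam _ => ⟨?_, ?_⟩⟩
    · refine le_trans ?_ (le_max_left _ _)
      refine norm_integral_le_of_norm_le (hw 0 (by norm_num)) ?_
      refine ae_restrict_of_forall_mem measurableSet_Ioi fun r hr => ?_
      simpa using hker_b lam hlam.1 0 r hr
    · refine le_trans ?_ (le_max_right _ _)
      refine norm_integral_le_of_norm_le (hw 1 (by norm_num)) ?_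
      refine ae_restrict_of_forall_mem measurableSet_Ioi fun r hr => ?_
      simpa using hker_b lam hlam.1 1 r hr

/-! ### One integration by parts: the induction step -/

/-- Integrability of `f e^{λ(r−r₁)}` on `(r₁, ∞)` for `Re λ < 0` and polynomially bounded
continuous `f`. [folklore] -/
theorem integrableOn_mul_cexp_of_norm_le {f : ℝ → ℂ} {r₁ C : ℝ} {k : ℕ} {lam : ℂ}
    (hlam : lam.re < 0) (hfc : ContinuousOn f (Ici r₁)) (hfb : ∀ r ∈ Ici r₁, ‖f r‖ ≤ C * (1 + r) ^ k) :
    IntegrableOn (fun r => f r * Complex.exp (lam * ((r - r₁ : ℝ) : ℂ))) (Ioi r₁) := by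
  have hc : 0 < -lam.re := by linarith
  have hec : Continuous fun r : ℝ => Complex.exp (lam * ((r - r₁ : ℝ) : ℂ)) :=
    Complex.continuous_exp.comp (continuous_const.mul
      (Complex.continuous_ofReal.comp (continuous_id.sub continuous_const)))
  refine integrableOn_Ioi_of_norm_le_exp_mul_pow (C := C) (n := k) hc r₁
    ((hfc.mono Ioi_subset_Ici_self).mul hec.continuousOn) fun r hr => ?_
  rw [norm_mul, norm_exp_mul_sub]
  have h1 := hfb r (mem_Ici.2 (le_of_lt hr))
  have hE := Real.exp_pos (lam.re * (r - r₁))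
  calc ‖f r‖ * Real.exp (lam.re * (r - r₁)) ≤ C * (1 + r) ^ k * Real.exp (lam.re * (r - r₁)) :=
        mul_le_mul_of_nonneg_right h1 hE.le
    _ = C * (Real.exp (-(-lam.re) * (r - r₁)) * (1 + r) ^ k) := by rw [neg_neg]; ring

/-- **The induction step: one integration by parts.** If `g ∈ C¹[r₁, ∞)` (`r₁ ≥ 0`) with `g, g'`
polynomially bounded and `(F₁, F₁')` is a half-line regularisation of `g'`, then
`F(λ) = −g(r₁)/λ − F₁(λ)/λ`, `F'(λ) = g(r₁)/λ² + F₁(λ)/λ² − F₁'(λ)/λ` is one of `g`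
(TdC Lemma 3.10: each integration by parts against `e^{A(z−r₋)(r−r₋)}` costs a factor
`1/(A(z−r₋))`). [cite: Costa2019, Lemma 3.10] -/
theorem IsHalfLineRegularisation.of_hasDerivAt {g g' : ℝ → ℂ} {r₁ C : ℝ} {k : ℕ}
    {F₁ F₁' : ℂ → ℂ} (hr₁ : 0 ≤ r₁)
    (hg : ∀ r ∈ Ici r₁, HasDerivAt g (g' r) r) (hg'c : ContinuousOn g' (Ici r₁))
    (hgb : ∀ r ∈ Ici r₁, ‖g r‖ ≤ C * (1 + r) ^ k) (hg'b : ∀ r ∈ Ici r₁, ‖g' r‖ ≤ C * (1 + r) ^ k)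
    (h₁ : IsHalfLineRegularisation r₁ g' F₁ F₁') :
    IsHalfLineRegularisation r₁ g (fun lam => -(g r₁) * lam⁻¹ - lam⁻¹ * F₁ lam)
      (fun lam => g r₁ * (lam ^ 2)⁻¹ + (lam ^ 2)⁻¹ * F₁ lam - lam⁻¹ * F₁' lam) := by
  obtain ⟨ha, ha', hb, hb', hc, C₁, hd⟩ := h₁
  have hgc : ContinuousOn g (Ici r₁) := fun r hr => (hg r hr).continuousAt.continuousWithinAt
  have hC : 0 ≤ C := by
    have h := (norm_nonneg _).trans (hgb r₁ self_mem_Ici)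
    exact le_of_mul_le_mul_right (by simpa using h) (by positivity)
  -- the companion function `f = (r − r₁) g`, `f' = g' (r − r₁) + g`
  have hf : ∀ r ∈ Ici r₁, HasDerivAt (fun x => g x * ((x - r₁ : ℝ) : ℂ))
      (g' r * ((r - r₁ : ℝ) : ℂ) + g r) r := by
    intro r hr
    have h0 : HasDerivAt (fun x : ℝ => ((x - r₁ : ℝ) : ℂ)) 1 r := by
      simpa using ((hasDerivAt_id r).sub_const r₁).ofReal_comp
    exact ((hg r hr).mul h0).congr_deriv (by rw [mul_one])
  have hfc' : ContinuousOn (fun r => g' r * ((r - r₁ : ℝ) : ℂ) + g r) (Ici r₁) :=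
    (hg'c.mul (Complex.continuous_ofReal.comp (continuous_id.sub continuous_const)).continuousOn).add
      hgc
  have hle1 : ∀ r ∈ Ici r₁, ‖((r - r₁ : ℝ) : ℂ)‖ ≤ 1 + r := fun r hr => by
    rw [Complex.norm_real, Real.norm_eq_abs, abs_of_nonneg (sub_nonneg.2 (mem_Ici.1 hr))]
    linarith [mem_Ici.1 hr]
  have hfb : ∀ r ∈ Ici r₁, ‖g r * ((r - r₁ : ℝ) : ℂ)‖ ≤ 2 * C * (1 + r) ^ (k + 1) := by
    intro r hr
    have hr0 : 0 ≤ 1 + r := by linarith [mem_Ici.1 hr]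
    rw [norm_mul, pow_succ]
    calc ‖g r‖ * ‖((r - r₁ : ℝ) : ℂ)‖ ≤ C * (1 + r) ^ k * (1 + r) :=
          mul_le_mul (hgb r hr) (hle1 r hr) (norm_nonneg _) (by positivity)
      _ ≤ 2 * C * ((1 + r) ^ k * (1 + r)) := by
          nlinarith [mul_nonneg hC (mul_nonneg (pow_nonneg hr0 k) hr0)]
  have hfb' : ∀ r ∈ Ici r₁, ‖g' r * ((r - r₁ : ℝ) : ℂ) + g r‖ ≤ 2 * C * (1 + r) ^ (k + 1) := by
    intro r hr
    have hr0 : 0 ≤ 1 + r := by linarith [mem_Ici.1 hr]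
    have h1r : 1 ≤ 1 + r := by linarith [mem_Ici.1 hr]
    calc ‖g' r * ((r - r₁ : ℝ) : ℂ) + g r‖ ≤ ‖g' r * ((r - r₁ : ℝ) : ℂ)‖ + ‖g r‖ := norm_add_le _ _
      _ ≤ C * (1 + r) ^ k * (1 + r) + C * (1 + r) ^ k * 1 := by
          rw [norm_mul]
          exact add_le_add (mul_le_mul (hg'b r hr) (hle1 r hr) (norm_nonneg _) (by positivity))
            (by simpa using hgb r hr)
      _ ≤ 2 * C * (1 + r) ^ (k + 1) := by
          rw [pow_succ]; nlinarith [pow_nonneg hr0 k, mul_nonneg hC (pow_nonneg hr0 k)]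
  refine ⟨fun lam hlam => ?_, fun lam hlam => ?_, ?_, ?_, fun lam hlam => ?_, ?_⟩
  · -- (a): one integration by parts
    show -(g r₁) * lam⁻¹ - lam⁻¹ * F₁ lam = _
    rw [integral_Ioi_mul_exp_eq_ibp hlam hg hg'c hgb hg'b, ha lam hlam, div_eq_mul_inv]
  · -- (a'): integrate `(r − r₁) g` by parts; the boundary term vanishes
    have hibp := integral_Ioi_mul_exp_eq_ibp hlam hf hfc' hfb hfb'
    have hsplit : ∫ r in Ioi r₁, (g' r * ((r - r₁ : ℝ) : ℂ) + g r) *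
        Complex.exp (lam * ((r - r₁ : ℝ) : ℂ)) =
        (∫ r in Ioi r₁, g' r * ((r - r₁ : ℝ) : ℂ) * Complex.exp (lam * ((r - r₁ : ℝ) : ℂ))) +
          ∫ r in Ioi r₁, g r * Complex.exp (lam * ((r - r₁ : ℝ) : ℂ)) := by
      rw [← integral_add]
      · refine integral_congr_ae (ae_of_all _ fun r => ?_); ring
      · have hb1 : ∀ r ∈ Ici r₁, ‖g' r * ((r - r₁ : ℝ) : ℂ)‖ ≤ C * (1 + r) ^ (k + 1) := by
          intro r hr
          have hr0 : 0 ≤ 1 + r := by linarith [mem_Ici.1 hr]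
          rw [norm_mul]
          calc ‖g' r‖ * ‖((r - r₁ : ℝ) : ℂ)‖ ≤ C * (1 + r) ^ k * (1 + r) :=
                mul_le_mul (hg'b r hr) (hle1 r hr) (norm_nonneg _) (mul_nonneg hC (pow_nonneg hr0 k))
            _ = C * (1 + r) ^ (k + 1) := by ring
        exact integrableOn_mul_cexp_of_norm_le hlam (hg'c.mul (Complex.continuous_ofReal.comp
          (continuous_id.sub continuous_const)).continuousOn) hb1
      · exact integrableOn_mul_cexp_of_norm_le hlam hgc hgb
    show g r₁ * (lam ^ 2)⁻¹ + (lam ^ 2)⁻¹ * F₁ lam - lam⁻¹ * F₁' lam = _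
    rw [hibp, hsplit, ← ha' lam hlam, integral_Ioi_mul_exp_eq_ibp hlam hg hg'c hgb hg'b,
      ← ha lam hlam]
    have hlam0 : lam ≠ 0 := fun h => by rw [h, Complex.zero_re] at hlam; exact lt_irrefl _ hlam
    simp only [sub_self, Complex.ofReal_zero, mul_zero, neg_zero, zero_div, zero_sub]
    field_simp
    ring
  · -- (b): continuity of `F` on `{Re λ ≤ 0, λ ≠ 0}`
    have hinv : ContinuousOn (fun lam : ℂ => lam⁻¹) leftHalfPlane₀ :=
      continuousOn_inv₀.mono fun lam hlam => hlam.2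
    exact ((continuousOn_const.mul hinv).sub (hinv.mul hb))
  · have hinv : ContinuousOn (fun lam : ℂ => lam⁻¹) leftHalfPlane₀ :=
      continuousOn_inv₀.mono fun lam hlam => hlam.2
    have hinv2 : ContinuousOn (fun lam : ℂ => (lam ^ 2)⁻¹) leftHalfPlane₀ :=
      (continuousOn_pow 2).inv₀ fun lam hlam => pow_ne_zero 2 hlam.2
    exact ((continuousOn_const.mul hinv2).add (hinv2.mul hb)).sub (hinv.mul hb')
  · -- (c): derivative within the half-plane
    have hlam0 : lam ≠ 0 := hlam.2
    have hi : HasDerivWithinAt (fun mu : ℂ => mu⁻¹) (-(lam ^ 2)⁻¹) leftHalfPlane₀ lam :=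
      (hasDerivAt_inv hlam0).hasDerivWithinAt
    have h1 := hi.const_mul (-(g r₁))
    have h2 := hi.mul (hc lam hlam)
    refine (h1.sub h2).congr_deriv ?_
    ring
  · -- (d): bounds for `|λ| ≥ 1`
    refine ⟨‖g r₁‖ + |C₁| + |C₁|, fun lam hlam h1 => ?_⟩
    have hi1 : ‖lam⁻¹‖ ≤ 1 := by rw [norm_inv]; exact inv_le_one_of_one_le₀ h1
    have hi2 : ‖(lam ^ 2)⁻¹‖ ≤ 1 := by
      rw [norm_inv, norm_pow]; exact inv_le_one_of_one_le₀ (one_le_pow₀ h1)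
    have hF := (hd lam hlam h1).1.trans (le_abs_self C₁)
    have hF' := (hd lam hlam h1).2.trans (le_abs_self C₁)
    have hF0 : 0 ≤ ‖F₁ lam‖ := norm_nonneg _
    constructor
    · calc ‖-(g r₁) * lam⁻¹ - lam⁻¹ * F₁ lam‖ ≤ ‖-(g r₁) * lam⁻¹‖ + ‖lam⁻¹ * F₁ lam‖ := norm_sub_le _ _
        _ ≤ ‖g r₁‖ * 1 + 1 * |C₁| := by
            rw [norm_mul, norm_mul, norm_neg]
            exact add_le_add (mul_le_mul_of_nonneg_left hi1 (norm_nonneg _))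
              (mul_le_mul hi1 hF hF0 zero_le_one)
        _ ≤ ‖g r₁‖ + |C₁| + |C₁| := by linarith [abs_nonneg C₁]
    · calc ‖g r₁ * (lam ^ 2)⁻¹ + (lam ^ 2)⁻¹ * F₁ lam - lam⁻¹ * F₁' lam‖ ≤
          ‖g r₁ * (lam ^ 2)⁻¹ + (lam ^ 2)⁻¹ * F₁ lam‖ + ‖lam⁻¹ * F₁' lam‖ := norm_sub_le _ _
        _ ≤ ‖g r₁ * (lam ^ 2)⁻¹‖ + ‖(lam ^ 2)⁻¹ * F₁ lam‖ + ‖lam⁻¹ * F₁' lam‖ :=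
            add_le_add (norm_add_le _ _) le_rfl
        _ ≤ ‖g r₁‖ * 1 + 1 * |C₁| + 1 * |C₁| := by
            rw [norm_mul, norm_mul, norm_mul]
            exact add_le_add (add_le_add (mul_le_mul_of_nonneg_left hi2 (norm_nonneg _))
              (mul_le_mul hi2 hF hF0 zero_le_one)) (mul_le_mul hi1 hF' (norm_nonneg _) zero_le_one)
        _ = ‖g r₁‖ + |C₁| + |C₁| := by ring

/-! ### Regularisation of symbols by induction on the degree -/

/-- `r^d ≤ max(1, r₁^d) (1 + r)^{d⁺}` for `r ≥ r₁ > 0` (polynomial bound of an integer power).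
[folklore] -/
theorem zpow_le_max_mul_pow {r₁ r : ℝ} (hr₁ : 0 < r₁) (hr : r₁ ≤ r) (d : ℤ) :
    r ^ d ≤ max 1 (r₁ ^ d) * (1 + r) ^ d.toNat := by
  have hr0 : 0 < r := hr₁.trans_le hr
  rcases le_or_gt 0 d with hd | hd
  · obtain ⟨k, rfl⟩ := Int.eq_ofNat_of_zero_le hd
    rw [Int.toNat_natCast, zpow_natCast]
    calc r ^ k ≤ (1 + r) ^ k := pow_le_pow_left₀ hr0.le (by linarith) k
      _ ≤ max 1 (r₁ ^ (k : ℤ)) * (1 + r) ^ k :=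
          le_mul_of_one_le_left (pow_nonneg (by linarith) k) (le_max_left _ _)
  · have htn : d.toNat = 0 := Int.toNat_eq_zero.2 hd.le
    rw [htn, pow_zero, mul_one]
    refine le_trans ?_ (le_max_right _ _)
    obtain ⟨k, hk⟩ := Int.eq_ofNat_of_zero_le (by omega : 0 ≤ -d)
    have hd' : d = -(k : ℤ) := by omega
    rw [hd', zpow_neg, zpow_neg, zpow_natCast, zpow_natCast]
    exact inv_anti₀ (pow_pos hr₁ k) (pow_le_pow_left₀ hr₁.le hr k)

/-- **Regularisation of the Laplace-type integral of a symbol** (TdC Lemma 3.10 / 3.12 in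
abstract form). For `g ∈ IsInvSmooth r₀ d` and `r₁ > r₀ > 0` the integral
`∫_{r₁}^∞ g(r) e^{λ(r−r₁)} dr` (`Re λ < 0`) admits a half-line regularisation `(F, F')`:
continuous on `{Re λ ≤ 0, λ ≠ 0}` with `F'` the derivative of `F` within that set and both
bounded for `|λ| ≥ 1`. Proof by induction on `d + 4`: for `d ≤ −4` the integral converges
absolutely on the closed half-plane; otherwise integrate by parts once, `g' ∈ IsInvSmooth` of
degree `d − 1`. [cite: Costa2019, Lemma 3.10, Lemma 3.12] -/
theorem IsInvSmooth.exists_halfLineRegularisation {r₀ r₁ : ℝ} (hr₀ : 0 < r₀) (hr₁ : r₀ < r₁) :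
    ∀ (n : ℕ) {d : ℤ} {g : ℝ → ℂ}, d + 4 ≤ n → IsInvSmooth r₀ d g →
      ∃ F F' : ℂ → ℂ, IsHalfLineRegularisation r₁ g F F' := by
  have hr₁0 : 0 < r₁ := hr₀.trans hr₁
  intro n
  induction n with
  | zero =>
    intro d g hd hg
    obtain ⟨C, hC⟩ := hg.norm_le hr₀
    exact ⟨_, _, isHalfLineRegularisation_of_norm_le hr₀ hr₁ (by omega) (hg.continuousOn hr₀) hC⟩
  | succ n ih =>
    intro d g hd hg
    by_cases hdn : d + 4 ≤ n
    · exact ih hdn hg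
    · -- `d + 4 = n + 1`: integrate by parts once
      obtain ⟨g', hg', hgd⟩ := hg.hasDerivAt hr₀
      obtain ⟨F₁, F₁', h₁⟩ := ih (d := d - 1) (by omega) hg'
      obtain ⟨Cg, hCg⟩ := hg.norm_le hr₀
      obtain ⟨Cg', hCg'⟩ := hg'.norm_le hr₀
      -- polynomial bounds on `[r₁, ∞)` with a common constant and exponent
      set K : ℕ := d.toNat with hK
      set B : ℝ := |Cg| * max 1 (r₁ ^ d) + |Cg'| * max 1 (r₁ ^ (d - 1)) with hB
      have hbound : ∀ {c : ℝ} {e : ℤ} {h : ℝ → ℂ}, (∀ r, r₀ < r → ‖h r‖ ≤ c * r ^ e) →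
          e.toNat ≤ K → ∀ r ∈ Ici r₁, ‖h r‖ ≤ |c| * max 1 (r₁ ^ e) * (1 + r) ^ K := by
        intro c e h hh he r hr
        have hr' : r₁ ≤ r := mem_Ici.1 hr
        have hr0 : 0 < r := hr₁0.trans_le hr'
        have h1 := hh r (hr₁.trans_le hr')
        have h2 : r ^ e ≤ max 1 (r₁ ^ e) * (1 + r) ^ e.toNat := zpow_le_max_mul_pow hr₁0 hr' e
        have h3 : (1 + r) ^ e.toNat ≤ (1 + r) ^ K := pow_le_pow_right₀ (by linarith) he
        have hm : 0 ≤ max 1 (r₁ ^ e) := le_trans zero_le_one (le_max_left _ _)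
        calc ‖h r‖ ≤ c * r ^ e := h1
          _ ≤ |c| * r ^ e := mul_le_mul_of_nonneg_right (le_abs_self c) (zpow_nonneg hr0.le _)
          _ ≤ |c| * (max 1 (r₁ ^ e) * (1 + r) ^ K) :=
              mul_le_mul_of_nonneg_left (h2.trans (mul_le_mul_of_nonneg_left h3 hm)) (abs_nonneg c)
          _ = |c| * max 1 (r₁ ^ e) * (1 + r) ^ K := by ring
      have hgb : ∀ r ∈ Ici r₁, ‖g r‖ ≤ B * (1 + r) ^ K := by
        intro r hr
        have h := hbound hCg le_rfl r hr
        have hK0 : 0 ≤ (1 + r) ^ K := pow_nonneg (by linarith [mem_Ici.1 hr]) K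
        have : 0 ≤ |Cg'| * max 1 (r₁ ^ (d - 1)) * (1 + r) ^ K :=
          mul_nonneg (mul_nonneg (abs_nonneg _) (le_trans zero_le_one (le_max_left _ _))) hK0
        rw [hB]; nlinarith
      have hg'b : ∀ r ∈ Ici r₁, ‖g' r‖ ≤ B * (1 + r) ^ K := by
        intro r hr
        have h := hbound hCg' (by rw [hK]; exact Int.toNat_le_toNat (by omega)) r hr
        have hK0 : 0 ≤ (1 + r) ^ K := pow_nonneg (by linarith [mem_Ici.1 hr]) K
        have : 0 ≤ |Cg| * max 1 (r₁ ^ d) * (1 + r) ^ K :=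
          mul_nonneg (mul_nonneg (abs_nonneg _) (le_trans zero_le_one (le_max_left _ _))) hK0
        rw [hB]; nlinarith
      refine ⟨_, _, IsHalfLineRegularisation.of_hasDerivAt hr₁0.le (fun r hr => hgd r
        (hr₁.trans_le (mem_Ici.1 hr))) ((hg'.continuousOn hr₀).mono fun r hr =>
          hr₁.trans_le (mem_Ici.1 hr)) hgb hg'b h₁⟩

/-- **Regularisation of a symbol**, packaged without the induction parameter.
[cite: Costa2019, Lemma 3.10, Lemma 3.12] -/
theorem IsInvSmooth.exists_halfLineRegularisation' {r₀ r₁ : ℝ} {d : ℤ} {g : ℝ → ℂ}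
    (hr₀ : 0 < r₀) (hr₁ : r₀ < r₁) (hg : IsInvSmooth r₀ d g) :
    ∃ F F' : ℂ → ℂ, IsHalfLineRegularisation r₁ g F F' :=
  IsInvSmooth.exists_halfLineRegularisation hr₀ hr₁ (d + 4).toNat (Int.self_le_toNat _) hg

/-! ### From `λ`-derivatives within the half-plane to `x`-derivatives along `λ = αx + β` -/

/-- If `F` has derivative `F'` within `S` at `αx + β` and the real line `t ↦ αt + β` stays in
`S`, then `t ↦ F(αt + β)` has derivative `F' α` at `x` (chain rule over `ℝ`). This converts the
`λ`-regularity of the regularised integrals into `x`-regularity of Whiting's transform on and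
off the real axis (`λ = A(x + iy − r₋)`). [folklore] -/
theorem hasDerivAt_comp_affine_of_hasDerivWithinAt {F : ℂ → ℂ} {F' α β : ℂ} {S : Set ℂ}
    {x : ℝ} (hF : HasDerivWithinAt F F' S (α * x + β)) (hS : ∀ t : ℝ, α * t + β ∈ S) :
    HasDerivAt (fun t : ℝ => F (α * t + β)) (F' * α) x := by
  have h1 := (hF.hasFDerivWithinAt).restrictScalars ℝ
  have h2 : HasDerivAt (fun t : ℝ => α * t + β) α x := by
    have h0 : HasDerivAt (fun t : ℝ => (t : ℂ)) 1 x := by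
      simpa using (hasDerivAt_id x).ofReal_comp
    simpa using (h0.const_mul α).add_const β
  have h3 := h1.comp_hasDerivWithinAt x (h2.hasDerivWithinAt (s := univ)) fun t _ => hS t
  have h4 : HasDerivAt (F ∘ fun t : ℝ => α * t + β)
      ((ContinuousLinearMap.restrictScalars ℝ
        (ContinuousLinearMap.smulRight (1 : ℂ →L[ℂ] ℂ) F')) α) x :=
    h3.hasDerivAt Filter.univ_mem
  refine h4.congr_deriv ?_
  simp [mul_comm]

end Costa2019

end Literature.Geometry.Lorentzian.Kerr

end
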